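import Summits.AnomalousDissipation.AnomalousDissipation.Theses.EnsembleRigidity
import Summits.AnomalousDissipation.AnomalousDissipation.Theorems.TameClosure.Negative.EscapingAtom
import Summits.AnomalousDissipation.AnomalousDissipation.Theorems.GPStatisticalRigidity.Negative.EulerSSS
import Summits.AnomalousDissipation.AnomalousDissipation.Theorems.GPStatisticalRigidity.Negative.DiracShadow
import Summits.AnomalousDissipation.AnomalousDissipation.Theorems.EnsembleRigidityGPStatisticalRigidityPartial
import Literature.Analysis.FluidPDE.StatisticalSolutionDirac
import HarnessLib

/-!
# `EnsembleRigidity.GPTameDefectFloor` (stmt-AnomalousDissipation-17938) — negative side: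
# normal form, load-bearing hypotheses, the proved region, and the kill switches

Crux-attack seat `refuter-rattack-stmt-AnomalousDissipation-17938-0` (2026-08-17). Kernel-checked knowledge about
the crux T = TAME DEFECT FLOOR OF `f_GP` ("for every level `(E, G₁)` there is `r > 0` such that no Borel probability
measure on `H` with integrable energy `≤ E` and mean enstrophy `≤ G₁` has Φ-uniform cylindrical forced-Euler defect
`≤ r`"). Nothing in this file asserts a Theses statement: every conclusion is a negation, an equivalence with a
local normal form, or a statement about the local predicate `TameFloorAt`.

* §0 `gpTameDefectFloor_iff`, `gpTameDefectFloor_iff_not_tameNearFamily` — NORMAL FORM: T is, level by level,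
  the negation of the hypothesis `TameNearFamily E G₁` of the sibling crux `TameRoughRigidity.TameClosure`
  (`Theorems/TameClosure/Negative/EscapingAtom.lean`): `T ↔ ∀ E G₁, ¬ TameNearFamily E G₁`.
* §1 LOAD-BEARING / IDLE HYPOTHESES. `tameClass_nonempty`: the tame class is inhabited at every `E ≥ 0` (Dirac
  mass at rest) — the `∀ μ` is not vacuous. `gpTameDefectFloor_false_without_prob`: with `IsProbabilityMeasure`
  deleted the ZERO MEASURE has defect `0 ≤ r·0` for every `r` — false. `gpTameDefectFloor_false_without_defect`:
  with the defect clause deleted T says the tame class is empty — false. `tameFloorAtNoInt_iff`: the clause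
  `Integrable ‖v‖²` is REDUNDANT (Poincaré, finite mean enstrophy).
* §2 THE ENERGY LEVEL IS IDLE; PROVED REGION. `tameFloorAt_of_poincareLevel`,
  `gpTameDefectFloor_iff_enstrophyLevels`: by the sharp Poincaré inequality `4π² e(μ) ≤ G(μ)` the crux is a
  statement about the mean-enstrophy level alone (`E` may be raised to `max G₁ 0 / (4π²)`).
  `tameFloorAt_of_smallEnergy` (`E < 3/(4π)`, any `G₁`) and `tameFloorAt_of_smallEnstrophy` (`G₁ < 3π`, any `E`)
  are the landed second-moment horizon; `gpTameDefectFloor_iff_largeEnstrophy`: what is OPEN is exactly the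
  half-line `G₁ ≥ 3π` at the Poincaré energy level `G₁/(4π²)`; `quadrant_of_not_gpTameDefectFloor`: a
  counterexample lives at a level with `E ≥ 3/(4π)` and `G₁ ≥ 3π`.
* §3 KILL SWITCHES. `not_gpTameDefectFloor_of_exactTameAt` / `…_of_eulerSSS` / `…_of_steadyWeakEuler`: ONE exact
  tame statistics — an FMRT stationary statistical solution of Euler forced by `f_GP` (any level), in particular the
  Dirac mass at ONE steady `H`-weak Euler solution `u ∈ V = H ∩ H¹` of `P(u·∇u) = f_GP` (finite enstrophy only) —
  refutes T. `not_gpStatisticalRigidity_of_not_gpTameDefectFloor`: a refutation of T refutes the route target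
  `GPStatisticalRigidity` too (desaturation + the level argument), so T carries no risk beyond X's.
* §5 DIRAC SHADOW. `tameResidualFloorAt_of_tameFloorAt`: tested on Dirac masses at smooth solenoidal mean-zero
  fields, T is a UNIFORM `H⁻¹`-residual floor on the tame ball `{∫|U|² ≤ E, ‖∇U‖₂² ≤ G₁}`;
  `not_gpTameDefectFloor_of_residualSoft`: a bounded-ENSTROPHY near-dodger sequence of smooth fields (residual
  bounds `rₙ → 0` at fixed `(E, G₁)`) kills T — the census' steady Galerkin dodger branch does so iff its enstrophy
  stays bounded while the full (untruncated) residual vanishes (observed: `G_min(K) = 82 → 436` growing, K ≤ 14).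
-/

noncomputable section

open MeasureTheory
open scoped ENNReal InnerProductSpace RealInnerProductSpace

-- every `Summit.AnomalousDissipation.AnomalousDissipation.…` name repeats the summit = sub-problem segment (D-0017 layout)
set_option linter.dupNamespace false

namespace Summit.AnomalousDissipation.AnomalousDissipation.Theorems.GPTameDefectFloor.Negative

open Literature.Analysis.FunctionSpaces Literature.Analysis.FluidPDE
open Summit.AnomalousDissipation.AnomalousDissipation.Theses.EnsembleRigidity (GPTameDefectFloor GPStatisticalRigidity)
open Summit.AnomalousDissipation.AnomalousDissipation.Theorems.EnsembleRigidity (gpForce gpForce_eq)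
open Summit.AnomalousDissipation.AnomalousDissipation.Theorems.TameClosure.Negative
  (TameNearFamily ExactTameAt not_tameNearFamily_smallEnergy not_tameNearFamily_smallEnstrophy
    ensembleEnergy_le_of_ensembleEnstrophy_le)

/-- Local notation: real vector fields on `T³`. -/
local notation "Vec3" => (UnitAddTorus (Fin 3)) → (EuclideanSpace ℝ (Fin 3))
/-- Local notation: `L²(T³; ℝ³)`. -/
local notation "L2" => (Lp (EuclideanSpace ℝ (Fin 3)) 2 (volume : Measure (UnitAddTorus (Fin 3))))
/-- Local notation: the energy space `H`. -/
local notation "H3" => (Torus.energySpace (Fin 3))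

/-! ## §0 Normal form: the crux level by level -/

/-- The cylindrical forced-Euler defect bound of `μ` with constant `r` for the force `f_GP` (the clause negated
in the crux). -/
def DefectLE (μ : Measure H3) (r : ℝ) : Prop :=
  ∀ Φ : Torus.CylindricalTest (Fin 3),
    Integrable (fun v : H3 => Torus.nsGeneratorPairing 0 gpForce v (Φ.grad v)) μ ∧
      |∫ v, Torus.nsGeneratorPairing 0 gpForce v (Φ.grad v) ∂μ| ≤
        r * Real.sqrt (∫ v, Torus.gradNormSq (Φ.grad v) ∂μ)

/-- The crux AT ONE LEVEL `(E, G₁)`: a defect radius `r > 0` met by no tame probability measure. -/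
def TameFloorAt (E G₁ : ℝ) : Prop :=
  ∃ r : ℝ, 0 < r ∧ ∀ μ : Measure H3, IsProbabilityMeasure μ → Integrable (fun v : H3 => ‖v‖ ^ 2) μ →
    Torus.ensembleEnergy μ ≤ E → Torus.ensembleEnstrophy μ ≤ ENNReal.ofReal G₁ → ¬ DefectLE μ r

/-- The crux, unfolded: `TameFloorAt E G₁` at every level (the force is pinned by `rfl`). -/
theorem gpTameDefectFloor_iff : GPTameDefectFloor ↔ ∀ E G₁ : ℝ, TameFloorAt E G₁ := by
  constructor
  · intro h E G₁
    exact h gpForce gpForce_eq E G₁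
  · intro h f hf E G₁
    subst hf
    exact h E G₁

/-- At each level, T is the negation of the hypothesis `TameNearFamily` of the sibling crux `TameClosure`. -/
theorem tameFloorAt_iff_not_tameNearFamily (E G₁ : ℝ) : TameFloorAt E G₁ ↔ ¬ TameNearFamily E G₁ := by
  constructor
  · rintro ⟨r, hr, h⟩ hnear
    obtain ⟨μ, hprob, hint, hE, hG, hdef⟩ := hnear r hr
    exact h μ hprob hint hE hG hdef
  · intro h
    by_contra hcon
    refine h fun r hr => ?_
    by_contra hno
    exact hcon ⟨r, hr, fun μ hprob hint hE hG hdef => hno ⟨μ, hprob, hint, hE, hG, hdef⟩⟩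

/-- **Normal form.** `GPTameDefectFloor ↔ ∀ E G₁, ¬ TameNearFamily E G₁`. -/
theorem gpTameDefectFloor_iff_not_tameNearFamily :
    GPTameDefectFloor ↔ ∀ E G₁ : ℝ, ¬ TameNearFamily E G₁ := by
  rw [gpTameDefectFloor_iff]
  exact forall_congr' fun E => forall_congr' fun G₁ => tameFloorAt_iff_not_tameNearFamily E G₁

/-! ## §1 Non-vacuity; load-bearing and idle hypotheses -/

/-- **The tame class is inhabited** at every level `E ≥ 0` (and every `G₁`): the Dirac mass at rest has
integrable energy `0` and mean enstrophy `0`. So the `∀ μ` of the crux is never vacuous for `E ≥ 0`. -/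
theorem tameClass_nonempty {E : ℝ} (hE : 0 ≤ E) (G₁ : ℝ) :
    ∃ μ : Measure H3, IsProbabilityMeasure μ ∧ Integrable (fun v : H3 => ‖v‖ ^ 2) μ ∧
      Torus.ensembleEnergy μ ≤ E ∧ Torus.ensembleEnstrophy μ ≤ ENNReal.ofReal G₁ := by
  refine ⟨Measure.dirac 0, inferInstance, ?_, ?_, ?_⟩
  · exact (integrable_const (‖(0 : H3)‖ ^ 2)).congr (ae_eq_dirac (fun v : H3 => ‖v‖ ^ 2)).symm
  · unfold Torus.ensembleEnergy
    rw [integral_dirac]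
    simpa using hE
  · rw [GPStatisticalRigidity.Negative.ensembleEnstrophy_dirac_zero]
    exact bot_le

/-- The crux with `IsProbabilityMeasure μ` DELETED (everything else verbatim, force pinned). -/
def GPTameDefectFloorWithoutProb : Prop :=
  ∀ E G₁ : ℝ, ∃ r : ℝ, 0 < r ∧ ∀ μ : Measure H3, Integrable (fun v : H3 => ‖v‖ ^ 2) μ →
    Torus.ensembleEnergy μ ≤ E → Torus.ensembleEnstrophy μ ≤ ENNReal.ofReal G₁ → ¬ DefectLE μ r

/-- **Any proof must use the probability normalisation**: the ZERO MEASURE is "tame" at level `(0, 0)` and has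
defect `|0| ≤ r·√0` for every `r`, so the un-normalised statement is false. -/
theorem gpTameDefectFloor_false_without_prob : ¬ GPTameDefectFloorWithoutProb := by
  intro h
  obtain ⟨r, -, hall⟩ := h 0 0
  refine hall 0 integrable_zero_measure (by simp [Torus.ensembleEnergy]) (by simp [Torus.ensembleEnstrophy])
    fun Φ => ⟨integrable_zero_measure, ?_⟩
  simp

/-- The crux with the DEFECT CLAUSE DELETED: it then asserts that the tame class is empty. -/
def GPTameDefectFloorWithoutDefect : Prop :=
  ∀ E G₁ : ℝ, ∀ μ : Measure H3, IsProbabilityMeasure μ → Integrable (fun v : H3 => ‖v‖ ^ 2) μ →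
    Torus.ensembleEnergy μ ≤ E → Torus.ensembleEnstrophy μ ≤ ENNReal.ofReal G₁ → False

/-- **Any proof must use the defect clause**: the Dirac mass at rest is tame at level `(0, 0)`. -/
theorem gpTameDefectFloor_false_without_defect : ¬ GPTameDefectFloorWithoutDefect := by
  intro h
  obtain ⟨μ, hprob, hint, hE, hG⟩ := tameClass_nonempty le_rfl 0
  exact h 0 0 μ hprob hint hE hG

/-- The level statement with the clause `Integrable ‖v‖²` DELETED. -/
def TameFloorAtNoInt (E G₁ : ℝ) : Prop :=
  ∃ r : ℝ, 0 < r ∧ ∀ μ : Measure H3, IsProbabilityMeasure μ →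
    Torus.ensembleEnergy μ ≤ E → Torus.ensembleEnstrophy μ ≤ ENNReal.ofReal G₁ → ¬ DefectLE μ r

/-- **The energy-integrability clause is redundant** (Poincaré on `H`: finite mean enstrophy of a probability
measure forces integrable energy, `integrable_norm_sq_of_ensembleEnstrophy_lt_top`). -/
theorem tameFloorAtNoInt_iff (E G₁ : ℝ) : TameFloorAtNoInt E G₁ ↔ TameFloorAt E G₁ := by
  constructor
  · rintro ⟨r, hr, h⟩
    exact ⟨r, hr, fun μ hprob _ hE hG => h μ hprob hE hG⟩
  · rintro ⟨r, hr, h⟩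
    refine ⟨r, hr, fun μ hprob hE hG => h μ hprob ?_ hE hG⟩
    haveI := hprob
    exact GPStatisticalRigidity.Negative.integrable_norm_sq_of_ensembleEnstrophy_lt_top μ
      (hG.trans_lt ENNReal.ofReal_lt_top)

/-! ## §2 The energy level is idle; the proved region and the open half-line -/

/-- The level statement is anti-monotone in both levels (a larger class is a stronger claim). -/
theorem tameFloorAt_anti {E E' G₁ G₁' : ℝ} (hE : E ≤ E') (hG : G₁ ≤ G₁') (h : TameFloorAt E' G₁') :
    TameFloorAt E G₁ := by
  obtain ⟨r, hr, hall⟩ := h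
  exact ⟨r, hr, fun μ hprob hint hEμ hGμ => hall μ hprob hint (hEμ.trans hE)
    (hGμ.trans (ENNReal.ofReal_le_ofReal hG))⟩

/-- **The energy level is idle beyond the Poincaré value**: every tame measure at enstrophy level `G₁` has mean
energy `≤ max G₁ 0 / (4π²)`, so the statement at the Poincaré level gives it at every `E`. -/
theorem tameFloorAt_of_poincareLevel {G₁ : ℝ} (h : TameFloorAt (max G₁ 0 / (4 * Real.pi ^ 2)) G₁) (E : ℝ) :
    TameFloorAt E G₁ := by
  obtain ⟨r, hr, hall⟩ := h
  refine ⟨r, hr, fun μ hprob hint _ hG => hall μ hprob hint ?_ hG⟩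
  have key := ensembleEnergy_le_of_ensembleEnstrophy_le μ hint hG
  rw [le_div_iff₀ (by positivity)]
  linarith

/-- Hence the crux is a statement about the mean-enstrophy level ALONE. -/
theorem gpTameDefectFloor_iff_enstrophyLevels :
    GPTameDefectFloor ↔ ∀ G₁ : ℝ, TameFloorAt (max G₁ 0 / (4 * Real.pi ^ 2)) G₁ := by
  rw [gpTameDefectFloor_iff]
  exact ⟨fun h G₁ => h _ G₁, fun h E G₁ => tameFloorAt_of_poincareLevel (h G₁) E⟩

/-- **Proved region (a)**: below the energy horizon `E < 3/(4π)` the crux holds at every `G₁` (landed second-moment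
test with `w = f_GP`, `not_tameNearFamily_smallEnergy`). -/
theorem tameFloorAt_of_smallEnergy {E : ℝ} (hE : E < 3 / (4 * Real.pi)) (G₁ : ℝ) : TameFloorAt E G₁ :=
  (tameFloorAt_iff_not_tameNearFamily E G₁).2 (not_tameNearFamily_smallEnergy hE G₁)

/-- **Proved region (b)**: below the enstrophy horizon `G₁ < 3π` the crux holds at every `E`
(`not_tameNearFamily_smallEnstrophy`). -/
theorem tameFloorAt_of_smallEnstrophy (E : ℝ) {G₁ : ℝ} (hG : G₁ < 3 * Real.pi) : TameFloorAt E G₁ :=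
  (tameFloorAt_iff_not_tameNearFamily E G₁).2 (not_tameNearFamily_smallEnstrophy E hG)

/-- **What is open is one half-line**: the crux is equivalent to its instances at the levels
`(G₁/(4π²), G₁)` with `G₁ ≥ 3π`. -/
theorem gpTameDefectFloor_iff_largeEnstrophy :
    GPTameDefectFloor ↔ ∀ G₁ : ℝ, 3 * Real.pi ≤ G₁ → TameFloorAt (G₁ / (4 * Real.pi ^ 2)) G₁ := by
  rw [gpTameDefectFloor_iff_enstrophyLevels]
  constructor
  · intro h G₁ hG
    have h0 : 0 ≤ G₁ := le_trans (by positivity) hG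
    simpa [max_eq_left h0] using h G₁
  · intro h G₁
    by_cases hG : 3 * Real.pi ≤ G₁
    · have h0 : 0 ≤ G₁ := le_trans (by positivity) hG
      simpa [max_eq_left h0] using h G₁ hG
    · exact tameFloorAt_of_smallEnstrophy _ (not_le.1 hG)

/-- **Geography of a counterexample**: if the crux fails, a tame near-family exists at a level with
`E ≥ 3/(4π)` and `G₁ ≥ 3π`. -/
theorem quadrant_of_not_gpTameDefectFloor (h : ¬ GPTameDefectFloor) :
    ∃ E G₁ : ℝ, 3 / (4 * Real.pi) ≤ E ∧ 3 * Real.pi ≤ G₁ ∧ TameNearFamily E G₁ := by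
  rw [gpTameDefectFloor_iff_not_tameNearFamily] at h
  push Not at h
  obtain ⟨E, G₁, hnear⟩ := h
  exact ⟨E, G₁, not_lt.1 fun hE => not_tameNearFamily_smallEnergy hE G₁ hnear,
    not_lt.1 fun hG => not_tameNearFamily_smallEnstrophy E hG hnear, hnear⟩

/-! ## §3 Kill switches -/

/-- **Kill switch (exact tame statistics).** ONE stationary statistical solution of Euler forced by `f_GP` with
integrable energy `≤ E` and mean enstrophy `≤ G₁` refutes the crux (its defect is `0 ≤ r·√…` for every `r`). -/
theorem not_gpTameDefectFloor_of_exactTameAt {E G₁ : ℝ} (h : ExactTameAt E G₁) : ¬ GPTameDefectFloor := by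
  intro hT
  obtain ⟨μ, hsss, hint, hE, hG⟩ := h
  obtain ⟨r, hr, hall⟩ := gpTameDefectFloor_iff.1 hT E G₁
  refine hall μ hsss.prob hint hE hG fun Φ => ⟨(hsss.generator Φ).1, ?_⟩
  rw [(hsss.generator Φ).2, abs_zero]
  exact mul_nonneg hr.le (Real.sqrt_nonneg _)

/-- **Kill switch (FMRT form).** ONE stationary statistical solution of the Euler equations forced by `f_GP`
(`ν = 0`), at ANY level, refutes the crux — T quantifies over all levels `(E, G₁)`. -/
theorem not_gpTameDefectFloor_of_eulerSSS {μ : Measure H3}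
    (hμ : Torus.IsStationaryStatisticalSolution 0 gpForce μ) : ¬ GPTameDefectFloor := by
  haveI := hμ.prob
  have hG : Torus.ensembleEnstrophy μ < ⊤ := hμ.enstrophy_finite
  refine not_gpTameDefectFloor_of_exactTameAt (E := Torus.ensembleEnergy μ)
    (G₁ := (Torus.ensembleEnstrophy μ).toReal) ⟨μ, hμ, ?_, le_rfl, ?_⟩
  · exact GPStatisticalRigidity.Negative.integrable_norm_sq_of_ensembleEnstrophy_lt_top μ hG
  · rw [ENNReal.ofReal_toReal hG.ne]

/-- **Kill switch (finite-enstrophy dodger).** ONE steady `H`-weak solution `u ∈ V = H ∩ H¹` of Euler forced by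
`f_GP` (finite enstrophy only, no smoothness, any energy) refutes the crux, via the Dirac mass `δ_u`
(`isStationaryStatisticalSolution_dirac_holds`). -/
theorem not_gpTameDefectFloor_of_steadyWeakEuler {u : H3} (hV : (u : L2) ∈ Torus.energySpaceV (Fin 3))
    (hu : Torus.IsSteadyWeakSolution 0 gpForce u) : ¬ GPTameDefectFloor :=
  not_gpTameDefectFloor_of_eulerSSS
    (Torus.isStationaryStatisticalSolution_dirac_holds le_rfl
      (EnsembleRigidity.GPStatisticalRigidity.gpForce_admissible.1.memLp 2) (by simp) hV hu)

/-! ## §4 T is not riskier than the route target -/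

/-- **A refutation of T refutes `GPStatisticalRigidity`** (X ⇒ T): desaturate X (`gpStatisticalRigidity_noShell`,
the shell-work clause is idle) and run X at level `E` with the radius `r = min δ₀ (c / (2(√(max G₁ 0) + 1)))`
against a tame near-statistics: `c ≤ r √G ≤ c/2`, absurd. -/
theorem not_gpStatisticalRigidity_of_not_gpTameDefectFloor (h : ¬ GPTameDefectFloor) :
    ¬ GPStatisticalRigidity := by
  intro hX
  apply h
  rw [gpTameDefectFloor_iff_not_tameNearFamily]
  intro E G₁ hnear
  obtain ⟨c, δ₀, hc, hδ₀, hrig⟩ :=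
    EnsembleRigidity.GPStatisticalRigidity.gpStatisticalRigidity_noShell hX gpForce rfl E
  set s : ℝ := Real.sqrt (max G₁ 0) + 1 with hs
  have hs0 : 0 < s := by positivity
  set r : ℝ := min δ₀ (c / (2 * s)) with hr
  have hr0 : 0 < r := lt_min hδ₀ (by positivity)
  obtain ⟨μ, hprob, hint, hEμ, hGμ, hdef⟩ := hnear r hr0
  have hGtop : Torus.ensembleEnstrophy μ < ⊤ := hGμ.trans_lt ENNReal.ofReal_lt_top
  have key := hrig μ hprob hint hEμ hGtop r hr0.le (min_le_left _ _) hdef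
  have hsqrt : Real.sqrt (Torus.ensembleEnstrophy μ).toReal ≤ Real.sqrt (max G₁ 0) := by
    refine Real.sqrt_le_sqrt ?_
    have := ENNReal.toReal_mono ENNReal.ofReal_ne_top hGμ
    rwa [ENNReal.toReal_ofReal'] at this
  have h1 : r * Real.sqrt (Torus.ensembleEnstrophy μ).toReal ≤ (c / (2 * s)) * s :=
    mul_le_mul (min_le_right _ _) (hsqrt.trans (by linarith)) (Real.sqrt_nonneg _) (by positivity)
  have h2 : (c / (2 * s)) * s = c / 2 := by
    field_simp
  linarith

/-! ## §5 The Dirac shadow: a uniform residual floor on the tame ball of smooth fields -/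

open Summit.AnomalousDissipation.AnomalousDissipation.Theorems.GPStatisticalRigidity.Negative
  (ResidualLE integral_inner_fderiv_apply_eq_neg)
open Summit.AnomalousDissipation.AnomalousDissipation.Theorems.TaylorCertificatePair.Negative
  (norm_sq_of_ae eGradNormSq_congr_ae' nsGeneratorPairing_of_ae)

/-- T's single-field shadow at level `(E, G₁)`: a radius `r > 0` such that no smooth solenoidal mean-zero field
of energy `∫|U|² ≤ E` and `‖∇U‖₂² ≤ G₁` has `H⁻¹`-residual bound `|∫⟪(U·∇)U − f_GP, w⟫| ≤ r‖∇w‖₂` for all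
`w ∈ 𝒱` (`ResidualLE`, verbatim the residual clause of `VirtualDissipation.LambRigidGP`). -/
def TameResidualFloorAt (E G₁ : ℝ) : Prop :=
  ∃ r : ℝ, 0 < r ∧ ∀ U : Vec3, Torus.IsSmooth U → Torus.IsDivFree U → Torus.HasZeroMean U →
    ∫ x, ‖U x‖ ^ 2 ≤ E → Torus.gradNormSq U ≤ G₁ → ¬ ResidualLE gpForce U r

/-- **Dirac shadow.** The level statement tested on the Dirac mass at the `H`-state of a smooth solenoidal
mean-zero field is the uniform residual floor on the tame ball (same radius `r`). -/
theorem tameResidualFloorAt_of_tameFloorAt {E G₁ : ℝ} (h : TameFloorAt E G₁) : TameResidualFloorAt E G₁ := by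
  obtain ⟨r, hr, hall⟩ := h
  refine ⟨r, hr, fun U hU hdiv hzm hE hG hres => ?_⟩
  -- the state of `U`
  have hmem : (hU.memLp 2).toLp U ∈ Torus.energySpace (Fin 3) :=
    Torus.smoothSolenoidal_subset_energySpace ⟨U, hU, hdiv, hzm, MemLp.coeFn_toLp _⟩
  set u : H3 := ⟨(hU.memLp 2).toLp U, hmem⟩ with hu_def
  have hu : ((u : L2) : Vec3) =ᵐ[volume] U := (hU.memLp 2).coeFn_toLp
  -- `δ_u` is tame at level `(E, G₁)`
  have hI : Integrable (fun v : H3 => ‖v‖ ^ 2) (Measure.dirac u) :=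
    (integrable_const (‖u‖ ^ 2)).congr (ae_eq_dirac (fun v : H3 => ‖v‖ ^ 2)).symm
  have hEn : Torus.ensembleEnergy (Measure.dirac u) ≤ E := by
    unfold Torus.ensembleEnergy
    rw [integral_dirac, norm_sq_of_ae hu]
    exact hE
  have hGn : Torus.ensembleEnstrophy (Measure.dirac u) ≤ ENNReal.ofReal G₁ := by
    unfold Torus.ensembleEnstrophy
    rw [lintegral_dirac, eGradNormSq_congr_ae' hu, Torus.eGradNormSq_eq_ofReal_gradNormSq hU]
    exact ENNReal.ofReal_le_ofReal hG
  -- and its defect clause is the residual bound of `U`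
  refine hall (Measure.dirac u) inferInstance hI hEn hGn fun Φ => ⟨?_, ?_⟩
  · exact (integrable_const (Torus.nsGeneratorPairing 0 gpForce u (Φ.grad u))).congr
      (ae_eq_dirac (fun v : H3 => Torus.nsGeneratorPairing 0 gpForce v (Φ.grad v))).symm
  · rw [integral_dirac, integral_dirac]
    have hws : Torus.IsSmooth (Φ.grad u) := Torus.CylindricalTest.isSmooth_grad_holds Φ u
    have hwd : Torus.IsDivFree (Φ.grad u) := Torus.CylindricalTest.isDivFree_grad_holds Φ u
    have hwz : Torus.HasZeroMean (Φ.grad u) := Torus.CylindricalTest.hasZeroMean_grad_holds Φ u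
    have hf : Torus.IsSmooth gpForce := EnsembleRigidity.GPStatisticalRigidity.gpForce_admissible.1
    rw [nsGeneratorPairing_of_ae hu, zero_mul, add_zero, integral_inner_fderiv_apply_eq_neg hU hdiv hws]
    have i1 : Integrable (fun x => ⟪Torus.convect U U x, Φ.grad u x⟫_ℝ) volume :=
      ((hU.convect hU).inner hws).integrable
    have i2 : Integrable (fun x => ⟪gpForce x, Φ.grad u x⟫_ℝ) volume := (hf.inner hws).integrable
    have hsplit : (∫ x, ⟪gpForce x, Φ.grad u x⟫_ℝ) + -∫ x, ⟪Torus.convect U U x, Φ.grad u x⟫_ℝ =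
        -∫ x, ⟪Torus.convect U U x - gpForce x, Φ.grad u x⟫_ℝ := by
      simp_rw [inner_sub_left]
      rw [integral_sub i1 i2]
      ring
    rw [hsplit, abs_neg]
    exact hres _ hws hwd hwz

/-- **Kill switch (bounded-enstrophy near-dodgers).** If at ONE level `(E, G₁)` there are, for every `r > 0`,
smooth solenoidal mean-zero fields with `∫|U|² ≤ E`, `‖∇U‖₂² ≤ G₁` and `H⁻¹`-residual bound `r`, the crux is
false (no exact dodger and no limit needed). -/
theorem not_gpTameDefectFloor_of_residualSoft
    (hsoft : ∃ E G₁ : ℝ, ∀ r : ℝ, 0 < r → ∃ U : Vec3, Torus.IsSmooth U ∧ Torus.IsDivFree U ∧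
      Torus.HasZeroMean U ∧ ∫ x, ‖U x‖ ^ 2 ≤ E ∧ Torus.gradNormSq U ≤ G₁ ∧ ResidualLE gpForce U r) :
    ¬ GPTameDefectFloor := by
  intro hT
  obtain ⟨E, G₁, hEG⟩ := hsoft
  obtain ⟨r, hr, hall⟩ := tameResidualFloorAt_of_tameFloorAt (gpTameDefectFloor_iff.1 hT E G₁)
  obtain ⟨U, hU, hdiv, hzm, hE, hG, hres⟩ := hEG r hr
  exact hall U hU hdiv hzm hE hG hres

end Summit.AnomalousDissipation.AnomalousDissipation.Theorems.GPTameDefectFloor.Negative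

end
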